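import Mathlib.Combinatorics.SimpleGraph.Diam
import Mathlib.Data.Nat.Log
import Literature.Computability.Cryptography.SequenceProblems
import Literature.Computability.Cryptography.GraphPathProblems
import Literature.Computability.Cryptography.FGCoreProblems
import Literature.Computability.Cryptography.FGComplexity
import Literature.Computability.Complexity.CNF
import HarnessLib

-- provenance: harness21/H21/H21/Prelude/CryptoQuantFine/FGProblemZoo.lean @ d20076f (interim HEAD d8f2665); M5 mechanical rewrite
/-!
# The fine-grained problem zoo (trunk CryptoQuantFine, item F6)

Concrete `FGProblem`s (see `Literature.Prelude.CryptoQuantFine.FGComplexity`) for the central problems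
of fine-grained complexity, realising the notions `fg_core_problems`, `apsp_weighted` and
`edit_distance` as word-RAM problems with the size measure used in print. The math-level
predicates/functions come from `FGCoreProblems` (OV, `k`-OV, 3SUM, `k`-SUM, dominating set,
clique), `GraphPathProblems` (APSP, `(min,+)`-product, Negative Triangle, Radius),
`SequenceProblems` (edit distance, LCS, DTW, discrete Fréchet) and `CplxCore.CNF` (CNF-SAT).

| problem | `Inst` | `size` | `encode` | `Good` | source |
|---|---|---|---|---|---|
| `OV` | `OVInstance` (`n`, `d`, `A B : Fin n → Fin d → Bool`) | `n` | `n :: d ::` rows of `A`, then of `B`, one `0/1` word per bit | decision `HasOrthogonalPair` | R. Williams, TCS 2005 |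
| `OVWithDim c` | `OV` restricted to `d = c * ⌊log₂ n⌋` | `n` | as `OV` | as `OV` | VVW ICM 2018, §3 |
| `kOV k` | `KOVInstance k` | `n` | `n :: d ::` the `k` tables | decision `HasOrthogonalTuple` | Pătraşcu–Williams, SODA 2010 |
| `kOVWithDim k c` | `kOV k` restricted to `d = c * ⌊log₂ n⌋` | `n` | as `kOV k` | as `kOV k` | VVW ICM 2018, §3 |
| `threeSUM` | `l : List ℤ` with entries in `[-n³, n³]` | `n = l.length` | `encodeIntList l` | decision `HasThreeSum` | Gajentaan–Overmars 1995; Pătraşcu 2010 |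
| `kSUM k` | `l : List ℤ` with entries in `[-nᵏ, nᵏ]` | `n` | `encodeIntList l` | decision `HasKSum k` | Pătraşcu–Williams 2010; Abboud–Lewi–Williams, ESA 2014 |
| `APSP c` | `Σ n, Matrix (Fin n) (Fin n) (WithTop ℤ)`, weights in `[-nᶜ, nᶜ]`, no negative cycle | `n` | `encodeMatrixWithTop` | function: `encodeMatrixWithTop (shortestDist W)` | VW–W, J. ACM 2018, §1 |
| `NegativeTriangle c` | `Σ n, Matrix (Fin n) (Fin n) ℤ`, entries in `[-nᶜ, nᶜ]` | `n` | `encodeMatrixWithTop` of the coercion | decision `HasNegativeTriangle` | VW–W 2018, Thm 1.1 |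
| `MinPlusProduct c` | `Σ n`, two `n × n` matrices over `WithTop ℤ`, weights in `[-nᶜ, nᶜ]` | `n` | both `encodeMatrixWithTop`s concatenated | function: `encodeMatrixWithTop (minPlusProduct A B)` | VW–W 2018, §1 |
| `Radius c` | `Σ n, Matrix (Fin (n+1)) (Fin (n+1)) (WithTop ℤ)`, bounded, no negative cycle | `n + 1` | `encodeMatrixWithTop` | function: `[encodeWithTopInt (weightedRadius W)]` | Abboud–Grandoni–VW, SODA 2015 |
| `EditDistance` | `List Bool × List Bool` | `s.length + t.length` | `s.length ::` bits of `s ++ t` | function `[editDist s t]` | Backurs–Indyk, STOC 2015 |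
| `LCS` | `List Bool × List Bool` | `s.length + t.length` | as `EditDistance` | function `[lcsLength s t]` | Bringmann–Künnemann, FOCS 2015 |
| `DTW c` | nonempty `s t : List ℤ`, entries in `[-nᶜ, nᶜ]` | `n = s.length + t.length` | `s.length :: encodeIntList (s ++ t)` | function `[(dtwDist s t).toNat]` | Bringmann–Künnemann 2015 |
| `DiscreteFrechetDecision` | nonempty `P Q : List (ℤ × ℤ)`, threshold `τ² : ℕ` | `P.length + Q.length` | `P.length :: τ² ::` zig-zag coordinates | decision `discreteFrechet P Q ≤ √τ²` | Bringmann, FOCS 2014 |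
| `SparseDiameter` | `Σ n`, edge list `List (Fin n × Fin n)`, connected | `m` = number of listed edges | `n :: m ::` endpoints | function `[diam]` | Roditty–VW, STOC 2013 |
| `DiameterGapApprox α` | as `SparseDiameter` | `m` | as `SparseDiameter` | any `[D]` with `diam / α ≤ D ≤ diam` | Roditty–VW 2013 |
| `kDominatingSet k` | `Σ n, Matrix (Fin n) (Fin n) Bool` (adjacency bits) | `n` | `encodeBoolMatrix` | decision `HasDominatingSetOfCard _ k` | Pătraşcu–Williams 2010 |
| `kClique` | `CliqueInstance` (`k`, `n`, adjacency matrix on `Fin n`) | `n` | `k :: encodeBoolMatrix adj` | decision `HasKClique _ k` | Chen–Huang–Kanj–Xia, JCSS 2006; Nešetřil–Poljak 1985 |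
| `CNFSAT` | `CplxCore.CNF ℕ` | `numVars` | `numVars :: numClauses ::` clauses as `(length, 2·var + polarity …)` | decision `Satisfiable` | Impagliazzo–Paturi 2001 |
| `CNFSATWithSize c` | `CNFSAT` restricted to `numClauses + size ≤ (numVars + 1)ᶜ` | `numVars` | as `CNFSAT` | as `CNFSAT` | R. Williams, TCS 2005; VVW ICM 2018, §3 |
| `kSATProblem k` | `CNFSAT` restricted to `IsWidthLE k` and `List.Nodup` (no repeated clause) | `numVars` | as `CNFSAT` | as `CNFSAT` | Impagliazzo–Paturi 2001 |

Sources: V. Vassilevska Williams, *On some fine-grained questions in algorithms and complexity*,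
Proc. ICM 2018, §§2–4; V. Vassilevska Williams and R. Williams, *Subcubic equivalences between
path, matrix, and triangle problems*, J. ACM 65 (2018); M. Pătraşcu and R. Williams, *On the
possibility of faster SAT algorithms*, SODA 2010; A. Backurs and P. Indyk, STOC 2015;
K. Bringmann and M. Künnemann, FOCS 2015; K. Bringmann, *Why walking the dog takes time*, FOCS 2014;
L. Roditty and V. Vassilevska Williams, *Fast approximation algorithms for the diameter and radius
of sparse graphs*, STOC 2013; R. Impagliazzo and R. Paturi, *On the complexity of k-SAT*,
JCSS 2001.

## Mathlib

Used from Mathlib: `SimpleGraph.fromRel` (symmetrised, loop-free graph of a relation — so edge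
lists and adjacency matrices need no symmetry promise), `SimpleGraph.diam`,
`SimpleGraph.Connected`, `Nat.log`, `Real.sqrt`, `ENat.toNat`, `Matrix`. Mathlib has none of the
problems themselves (searched `OrthogonalVectors`, `threeSum`, `APSP`, `levenshtein`: no hits).

## Design choices

* Parameter regimes are `FGProblem.restrict`ions of an unrestricted problem, so `encode`, `size`,
  `Good` are inherited and the `restrict_*` simp lemmas apply.
* `OVWithDim c` fixes `d = c * Nat.log 2 n = c ⌊log₂ n⌋` (print: `d = c log n` with an unspecified
  rounding; any two conventions differ by a constant factor absorbed in `c`).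
* `kSUM k` bounds entries by `n ^ k` (Pătraşcu–Williams 2010 work over `[-n^k, n^k]` after hashing;
  Abboud–Lewi–Williams ESA 2014 show this range is without loss of generality); `threeSUM` uses
  `n ^ 3` (VVW ICM 2018, §3, footnote: `[-n³, n³]` suffices by Baran–Demaine–Pătraşcu / Pătraşcu 2010).
* `Radius c` indexes vertices by `Fin (n + 1)` so that the vertex type is nonempty, as required by
  `weightedRadius`; its size is the number of vertices `n + 1`.
* `DTW c` and `DiscreteFrechetDecision` are restricted to pairs of *nonempty* sequences: `dtwDist`
  and `discreteFrechet` take the junk value `⊤` when exactly one argument is empty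
  (`SequenceProblems`, OUTLINE R11), so on instances `dtwDist s t` is finite and `ENat.toNat`
  loses nothing, and the Fréchet comparison with `√τ²` is never against `⊤`.
* `SparseDiameter` / `DiameterGapApprox` are restricted to *connected* graphs: Mathlib's
  `SimpleGraph.diam` is `0` on graphs of infinite extended diameter, and Roditty–VW's sparse graphs
  are connected (so also `n ≤ m + 1` and the size `m` dominates the input length).
* `DiameterGapApprox α` accepts every integer `D` with `diam / α ≤ D ≤ diam` (an `α`-approximation
  from below, `α : ℚ`; the `(3/2 - δ)` statements instantiate `α = 3/2 - δ`).
* `kClique` carries the clique size `k` in the instance (visible to `InTimeInst` bounds such as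
  `n ^ (ω k / 3)`), whereas `kDominatingSet k`, `kOV k`, `kSUM k` fix `k` as a parameter, as in print.
  Both `kClique` and `kDominatingSet k` take adjacency matrices, so the input length is `n² + O(1)`
  and is controlled by the size `n` (an edge *list* could be padded with duplicates, making every
  size-only time bound vacuously false).
* **Input length vs. size.** A word RAM running in time `T` reads at most `T` input cells, so
  `P.InTime T` is only meaningful when the input length is bounded in terms of `P.size`. This holds
  for every problem below *except* the instance carriers `OV`, `kOV k` (dimension `d` unbounded) and
  `CNFSAT` (clauses may be repeated without bound): time-bound and `FGReducible` statements must be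
  made about `OVWithDim c`, `kOVWithDim k c`, `kSATProblem k` (width `≤ k`, no repeated clause, hence
  `≤ ∑_{j ≤ k} (2n)^j` clauses) or `CNFSATWithSize c` (encoding length `≤ (n+1)ᶜ + 2`), never about
  the bare carriers.
-/

namespace Literature.Computability.Cryptography

open Complexity

/-! ## Orthogonal vectors -/

/-- Encode a Boolean vector as `d` words `0`/`1`. (Input format of OV, VVW ICM 2018, §3.) [cite: ICM2018, §3] -/
def encodeBoolVec {d : ℕ} (v : Fin d → Bool) : List ℕ :=
  (List.finRange d).map fun t => (v t).toNat

/-- Word encoding of an OV instance: `n :: d ::` the `n` rows of `A` then the `n` rows of `B`,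
each row as `d` words `0`/`1`. (VVW ICM 2018, §3.) [cite: ICM2018, §3] -/
def OVInstance.encode (I : OVInstance) : List ℕ :=
  I.n :: I.d :: (((List.finRange I.n).flatMap fun i => encodeBoolVec (I.A i)) ++
    ((List.finRange I.n).flatMap fun i => encodeBoolVec (I.B i)))

/-- **Orthogonal Vectors** as a fine-grained decision problem: size `n` (number of vectors per
list), accept `[1]` iff there is an orthogonal pair. Instance carrier: the dimension `d` (hence
the input length `2 + 2nd`) is not bounded by the size `n`, so time-bound statements must go
through the `d = c log n` restriction `OVWithDim c`. R. Williams, TCS 348 (2005);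
VVW ICM 2018, §3. [cite: ICM2018, §3] -/
noncomputable def OV : FGProblem :=
  FGProblem.ofPred OVInstance.encode (·.n) OVInstance.HasOrthogonalPair

/-- OV in the regime `d = c ⌊log₂ n⌋` (`Nat.log 2`), the setting of the OV hypothesis
("for every `c`, no `n^{2-ε}` algorithm when `d = c log n`"; VVW ICM 2018, §3, Hypothesis 2).
Print leaves the rounding of `c log n` unspecified; conventions differ by a constant factor
absorbed in `c`. Junk regime: `OVWithDim 0` forces `d = 0`, where every pair is orthogonal (the
statements use `1 ≤ c`); likewise `n ≤ 1` gives `⌊log₂ n⌋ = 0`. [cite: ICM2018, §3  Hypothesis 2] -/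
noncomputable def OVWithDim (c : ℕ) : FGProblem :=
  OV.restrict {I : OVInstance | I.d = c * Nat.log 2 I.n}

/-- Word encoding of a `k`-OV instance: `n :: d ::` the `k` tables in order, each as `n` rows of
`d` words `0`/`1`. (Pătraşcu–Williams, SODA 2010.) [cite: SODA2010] -/
def KOVInstance.encode {k : ℕ} (I : KOVInstance k) : List ℕ :=
  I.n :: I.d :: (List.finRange k).flatMap fun l =>
    (List.finRange I.n).flatMap fun i => encodeBoolVec (I.vecs l i)

/-- **`k`-Orthogonal Vectors** as a fine-grained decision problem: size `n`, accept `[1]` iff there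
is an orthogonal `k`-tuple. Instance carrier (the dimension `d` is unbounded): time-bound
statements must go through `kOVWithDim k c`. Pătraşcu–Williams, SODA 2010; VVW ICM 2018, §3. [cite: SODA2010] -/
noncomputable def kOV (k : ℕ) : FGProblem :=
  FGProblem.ofPred (KOVInstance.encode (k := k)) (·.n) KOVInstance.HasOrthogonalTuple

/-- `k`-OV in the regime `d = c ⌊log₂ n⌋` (`Nat.log 2`), the setting of the `k`-OV hypothesis
(no `n^{k-ε}` algorithm when `d = c log n`, for every `c`; VVW ICM 2018, §3). Same rounding
convention and junk regime (`c = 0`) as `OVWithDim`. [cite: ICM2018, §3] -/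
noncomputable def kOVWithDim (k c : ℕ) : FGProblem :=
  (kOV k).restrict {I : KOVInstance k | I.d = c * Nat.log 2 I.n}

/-! ## 3SUM and `k`-SUM -/

/-- **3SUM** as a fine-grained decision problem: instances are integer lists `l` of length `n`
with entries in `[-n³, n³]`, encoded by `encodeIntList`, size `n`, accept `[1]` iff `HasThreeSum l`.
Gajentaan–Overmars, CGTA 1995; the `[-n³, n³]` normalisation is VVW ICM 2018, §3
(after Pătraşcu, STOC 2010). [cite: STOC2010] -/
noncomputable def threeSUM : FGProblem :=
  (FGProblem.ofPred encodeIntList List.length HasThreeSum).restrict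
    {l : List ℤ | HasBoundedEntries l (l.length ^ 3)}

/-- **`k`-SUM** as a fine-grained decision problem: integer lists of length `n` with entries in
`[-nᵏ, nᵏ]`, size `n`, accept `[1]` iff `HasKSum k l`. Pătraşcu–Williams, SODA 2010 (who state
`k`-SUM over arbitrary integers; the range `[-nᵏ, nᵏ]` is w.l.o.g. by Abboud–Lewi–Williams,
ESA 2014, and is the convention fixed here). Junk: `kSUM 0` accepts every instance
(`HasKSum 0` is trivially true). [cite: ESA2014, and is the convention fixed here] -/
noncomputable def kSUM (k : ℕ) : FGProblem :=
  (FGProblem.ofPred encodeIntList List.length (HasKSum k)).restrict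
    {l : List ℤ | HasBoundedEntries l (l.length ^ k)}

/-! ## APSP and its relatives -/

/-- Unrestricted APSP: instances `⟨n, W⟩` with `W : Matrix (Fin n) (Fin n) (WithTop ℤ)`, size `n`,
the unique accepted output is `encodeMatrixWithTop (shortestDist W)`. Auxiliary carrier; do not
state results about it: the problem of the literature is the restriction `APSP c`.
VW–W, J. ACM 65 (2018), §1. [folklore] -/
def APSPUnbounded : FGProblem :=
  FGProblem.ofFun (fun W : Σ n, Matrix (Fin n) (Fin n) (WithTop ℤ) => encodeMatrixWithTop W.2)
    (·.1) fun W => encodeMatrixWithTop (shortestDist W.2)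

/-- **APSP** with polynomially bounded integer weights as a fine-grained function problem:
`n`-vertex weighted digraphs `W` (`⊤` = no edge) with finite weights in `[-nᶜ, nᶜ]` and no
negative cycle; size `n`; output the matrix of shortest-path distances.
VW–W, J. ACM 65 (2018), §1; VVW ICM 2018, §4 (APSP hypothesis). [cite: ICM2018, §4 (APSP hypothesis] -/
def APSP (c : ℕ) : FGProblem :=
  APSPUnbounded.restrict {W : Σ n, Matrix (Fin n) (Fin n) (WithTop ℤ) |
    HasBoundedWeights W.2 (W.1 ^ c) ∧ HasNoNegativeCycle W.2}

/-- **Negative Triangle** as a fine-grained decision problem: complete integer-weighted digraphs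
`⟨n, W⟩`, `W : Matrix (Fin n) (Fin n) ℤ` with `|W i j| ≤ nᶜ`, encoded as `encodeMatrixWithTop`
of the (everywhere finite) weight matrix; size `n`; accept `[1]` iff `HasNegativeTriangle W`.
The weight bound is phrased as `HasBoundedWeights` of the encoded matrix `W.map (↑)`, uniformly
with `APSP c`. VW–W, J. ACM 65 (2018), Theorem 1.1. [folklore] -/
noncomputable def NegativeTriangle (c : ℕ) : FGProblem :=
  (FGProblem.ofPred
      (fun W : Σ n, Matrix (Fin n) (Fin n) ℤ => encodeMatrixWithTop (W.2.map (↑)))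
      (·.1) fun W => HasNegativeTriangle W.2).restrict
    {W : Σ n, Matrix (Fin n) (Fin n) ℤ | HasBoundedWeights (W.2.map (↑)) (W.1 ^ c)}

/-- **`(min,+)`-product** (distance product) as a fine-grained function problem: pairs of `n × n`
matrices over `ℤ ∪ {∞}` with finite entries in `[-nᶜ, nᶜ]`, encoded as the concatenation of the
two `encodeMatrixWithTop`s; size `n`; output `encodeMatrixWithTop (minPlusProduct A B)`.
VW–W, J. ACM 65 (2018), §1. [folklore] -/
def MinPlusProduct (c : ℕ) : FGProblem :=
  (FGProblem.ofFun
      (fun M : Σ n, Matrix (Fin n) (Fin n) (WithTop ℤ) × Matrix (Fin n) (Fin n) (WithTop ℤ) =>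
        encodeMatrixWithTop M.2.1 ++ encodeMatrixWithTop M.2.2)
      (·.1) fun M => encodeMatrixWithTop (minPlusProduct M.2.1 M.2.2)).restrict
    {M | HasBoundedWeights M.2.1 (M.1 ^ c) ∧ HasBoundedWeights M.2.2 (M.1 ^ c)}

/-- **Radius** of a weighted digraph as a fine-grained function problem: instances `⟨n, W⟩` with
`W : Matrix (Fin (n+1)) (Fin (n+1)) (WithTop ℤ)` (so the vertex set is nonempty), finite weights in
`[-(n+1)ᶜ, (n+1)ᶜ]`, no negative cycle; size `n + 1` (number of vertices); output the single word
`encodeWithTopInt (weightedRadius W)`. Abboud–Grandoni–Vassilevska Williams, SODA 2015 (Radius is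
subcubic-equivalent to APSP); VW–W, J. ACM 65 (2018), §1. [cite: SODA2015, (Radius is subcubic-equivalent to APSP] -/
def Radius (c : ℕ) : FGProblem :=
  (FGProblem.ofFun
      (fun W : Σ n, Matrix (Fin (n + 1)) (Fin (n + 1)) (WithTop ℤ) => encodeMatrixWithTop W.2)
      (fun W => W.1 + 1) fun W => [encodeWithTopInt (weightedRadius W.2)]).restrict
    {W | HasBoundedWeights W.2 ((W.1 + 1) ^ c) ∧ HasNoNegativeCycle W.2}

/-! ## Sequence problems -/

/-- Word encoding of a pair of bit strings: `|s| ::` the bits of `s ++ t` as words `0`/`1`.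
(Backurs–Indyk, STOC 2015, §2.) [cite: STOC2015, §2] -/
def encodeBoolPair (p : List Bool × List Bool) : List ℕ :=
  p.1.length :: (p.1 ++ p.2).map Bool.toNat

/-- **Edit Distance** (binary alphabet) as a fine-grained function problem: pairs of bit strings
`(s, t)`, size `|s| + |t|`, output `[editDist s t]`. Backurs–Indyk, STOC 2015 (binary alphabet
suffices for the SETH lower bound: Bringmann–Künnemann, FOCS 2015). [cite: FOCS2015] -/
def EditDistance : FGProblem :=
  FGProblem.ofFun encodeBoolPair (fun p => p.1.length + p.2.length) fun p => [editDist p.1 p.2]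

/-- **Longest Common Subsequence** (binary alphabet) as a fine-grained function problem: pairs of
bit strings, size `|s| + |t|`, output `[lcsLength s t]`. Abboud–Backurs–Vassilevska Williams,
FOCS 2015; Bringmann–Künnemann, FOCS 2015 (binary alphabet). [cite: FOCS2015] -/
def LCS : FGProblem :=
  FGProblem.ofFun encodeBoolPair (fun p => p.1.length + p.2.length) fun p => [lcsLength p.1 p.2]

/-- **Dynamic Time Warping** on integer sequences as a fine-grained function problem: pairs of
*nonempty* sequences `s t : List ℤ` with entries in `[-nᶜ, nᶜ]`, `n = |s| + |t|`, encoded as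
`|s| :: encodeIntList (s ++ t)`; size `n`; output `[(dtwDist s t).toNat]`. On instances both
sequences are nonempty, so `dtwDist s t ≠ ⊤` and `ENat.toNat` is faithful (the `⊤` junk value of
`dtwDist` only occurs when exactly one sequence is empty). Bringmann–Künnemann, FOCS 2015, §2. [cite: FOCS2015, §2] -/
def DTW (c : ℕ) : FGProblem :=
  (FGProblem.ofFun (fun p : List ℤ × List ℤ => p.1.length :: encodeIntList (p.1 ++ p.2))
      (fun p => p.1.length + p.2.length) fun p => [(dtwDist p.1 p.2).toNat]).restrict
    {p | p.1 ≠ [] ∧ p.2 ≠ [] ∧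
      HasBoundedEntries (p.1 ++ p.2) ((p.1.length + p.2.length) ^ c)}

/-- An instance of the discrete Fréchet decision problem: two vertex lists with integer
coordinates and a squared threshold `τ² : ℕ` (Bringmann, FOCS 2014, §2). [cite: FOCS2014, §2] -/
structure FrechetInstance where
  /-- The first polygonal curve. -/
  P : List (ℤ × ℤ)
  /-- The second polygonal curve. -/
  Q : List (ℤ × ℤ)
  /-- The squared distance threshold `τ²`. -/
  sqThreshold : ℕ

/-- Word encoding of a Fréchet instance: `|P| :: τ² ::` the zig-zag encoded coordinates
`x₁ y₁ x₂ y₂ …` of `P ++ Q`. (Bringmann, FOCS 2014.) [cite: FOCS2014] -/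
def FrechetInstance.encode (I : FrechetInstance) : List ℕ :=
  I.P.length :: I.sqThreshold ::
    (I.P ++ I.Q).flatMap fun p => [encodeInt p.1, encodeInt p.2]

/-- **Discrete Fréchet distance** (decision version) as a fine-grained problem: nonempty integer
curves `P, Q` and `τ² : ℕ`; size `|P| + |Q|`; accept `[1]` iff `discreteFrechet P Q ≤ √τ²`.
Nonemptiness excludes the `⊤` junk value of `discreteFrechet`. Bringmann, *Why walking the dog
takes time*, FOCS 2014, Thm 1.1 (no `n^{2-ε}` algorithm under SETH, even for the decision
version); Eiter–Mannila 1994. [cite: FOCS2014, Thm 1.1 (no  n^{2-ε}  algorithm under SE] -/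
noncomputable def DiscreteFrechetDecision : FGProblem :=
  (FGProblem.ofPred FrechetInstance.encode (fun I => I.P.length + I.Q.length) fun I =>
      discreteFrechet I.P I.Q ≤ ((Real.sqrt I.sqThreshold : ℝ) : WithTop ℝ)).restrict
    {I : FrechetInstance | I.P ≠ [] ∧ I.Q ≠ []}

/-! ## Graph problems -/

/-- The simple graph on `Fin n` spanned by an edge list (symmetrised, loops discarded), via
Mathlib's `SimpleGraph.fromRel`. [folklore] -/
def edgeListGraph {n : ℕ} (E : List (Fin n × Fin n)) : SimpleGraph (Fin n) :=
  SimpleGraph.fromRel fun a b => (a, b) ∈ E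

/-- Word encoding of an edge list on `Fin n`: `n :: m ::` the `2m` endpoints `u₁ v₁ u₂ v₂ …`
(adjacency-list / sparse input format; Roditty–Vassilevska Williams, STOC 2013). [cite: STOC2013] -/
def encodeEdgeList {n : ℕ} (E : List (Fin n × Fin n)) : List ℕ :=
  n :: E.length :: E.flatMap fun e => [(e.1 : ℕ), (e.2 : ℕ)]

/-- The simple graph on `Fin n` of a Boolean adjacency matrix (symmetrised, diagonal discarded),
via Mathlib's `SimpleGraph.fromRel`. [folklore] -/
def adjMatrixGraph {n : ℕ} (A : Matrix (Fin n) (Fin n) Bool) : SimpleGraph (Fin n) :=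
  SimpleGraph.fromRel fun i j => A i j = true

/-- Unrestricted sparse Diameter: instances `⟨n, E⟩` (edge list on `Fin n`), size `m = |E|`,
output `[(edgeListGraph E).diam]`. Auxiliary carrier; do not state results about it (see
`SparseDiameter`). Roditty–VW, STOC 2013. [cite: STOC2013] -/
noncomputable def SparseDiameterAll : FGProblem :=
  FGProblem.ofFun (fun G : Σ n, List (Fin n × Fin n) => encodeEdgeList G.2) (fun G => G.2.length)
    fun G => [(edgeListGraph G.2).diam]

/-- **Diameter of sparse (unweighted, undirected) graphs** as a fine-grained function problem:
connected graphs given by edge lists, size `m` = number of listed edges, output `[diam G]`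
(Mathlib's `SimpleGraph.diam`). Restricted to connected graphs, where `diam` is the honest
diameter and `n ≤ m + 1`. The size `m = |E|` counts duplicate, reversed and loop entries of the
list, so padded instances have inflated size; this only weakens upper bounds and is harmless for
the lower-bound statements (input length `2m + 2` is always controlled by the size).
Roditty–Vassilevska Williams, STOC 2013, Thm 1.3 (no `(3/2 - δ)`-approximation in `m^{2-ε}` time
under SETH). [cite: STOC2013, Thm 1.3 (no  (3/2 - δ] -/
noncomputable def SparseDiameter : FGProblem :=
  SparseDiameterAll.restrict {G : Σ n, List (Fin n × Fin n) | (edgeListGraph G.2).Connected}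

/-- **Approximate Diameter** with gap `α : ℚ` as a fine-grained relation problem on connected sparse
graphs (edge lists, size `m`): every single-word output `[D]` with `diam / α ≤ D ≤ diam` is
accepted (an `α`-approximation from below). Roditty–Vassilevska Williams, STOC 2013, Thm 1.3
(`α = 3/2 - δ`). For `α ≤ 0` the lower constraint is vacuous or unsatisfiable (junk regime; the
statements use `1 ≤ α`). [cite: STOC2013, Thm 1.3 ( α = 3/2 - δ] -/
noncomputable def DiameterGapApprox (α : ℚ) : FGProblem :=
  ({ Inst := Σ n, List (Fin n × Fin n)
     encode := fun G => encodeEdgeList G.2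
     size := fun G => G.2.length
     Good := fun G => {out | ∃ D : ℕ, out = [D] ∧
       ((edgeListGraph G.2).diam : ℚ) / α ≤ D ∧ D ≤ (edgeListGraph G.2).diam} } : FGProblem).restrict
    {G : Σ n, List (Fin n × Fin n) | (edgeListGraph G.2).Connected}

/-- **`k`-Dominating Set** as a fine-grained decision problem: `n`-vertex graphs given by their
Boolean adjacency matrix (`encodeBoolMatrix`), size `n`, accept `[1]` iff there is a dominating set
of at most `k` vertices. Pătraşcu–Williams, SODA 2010, Thm 1.2 (no `n^{k-ε}` algorithm for
`k ≥ 3` under SETH). [cite: SODA2010, Thm 1.2 (no  n^{k-ε}  algorithm for  k ≥] -/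
noncomputable def kDominatingSet (k : ℕ) : FGProblem :=
  FGProblem.ofPred (fun G : Σ n, Matrix (Fin n) (Fin n) Bool => encodeBoolMatrix G.2) (·.1)
    fun G => HasDominatingSetOfCard (adjMatrixGraph G.2) k

/-- An instance of `k`-Clique with `k` part of the input: the clique size `k`, the number of
vertices `n`, and a Boolean adjacency matrix on `Fin n` (read through `adjMatrixGraph`, i.e.
symmetrised with the diagonal ignored). Adjacency-matrix input is the format of the
`O(n^{ωk/3})` algorithm (Nešetřil–Poljak, CMUC 26 (1985)) and keeps the input length `n² + 2`
controlled by the size `n`. (Chen–Huang–Kanj–Xia, JCSS 2006.) [cite: JCSS2006] -/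
structure CliqueInstance where
  /-- The clique size sought. -/
  k : ℕ
  /-- The number of vertices. -/
  n : ℕ
  /-- The adjacency matrix. -/
  adj : Matrix (Fin n) (Fin n) Bool

/-- **`k`-Clique** as a fine-grained decision problem with `k` in the instance: encoding
`k :: encodeBoolMatrix adj` (length `n² + 2`), size `n`, accept `[1]` iff the graph has a
`k`-clique (`HasKClique`, i.e. `¬ CliqueFree k`). Since `k` is a field of the instance,
per-instance time bounds (`FGProblem.InTimeInst`) such as `n^{ω k / 3}` or `f(k) · n^{o(k)}` can
refer to it. Chen–Huang–Kanj–Xia, JCSS 72 (2006), Thm 5.6 (no `f(k) n^{o(k)}` algorithm under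
ETH); Nešetřil–Poljak 1985. [cite: Poljak1985] -/
noncomputable def kClique : FGProblem :=
  FGProblem.ofPred (fun I : CliqueInstance => I.k :: encodeBoolMatrix I.adj) (·.n)
    fun I => HasKClique (adjMatrixGraph I.adj) I.k

/-! ## CNF-SAT -/

/-- Word encoding of a CNF over variables `ℕ`: `numVars :: numClauses ::` then, for each clause,
its length followed by its literals encoded as `2 * var + polarity` (`polarity = 1` for a
positive literal). Impagliazzo–Paturi, JCSS 2001, §1 (formulas given as clause lists). [cite: JCSS2001, §1 (formulas given as clause lists] -/
def encodeCNFWords (φ : CNF ℕ) : List ℕ :=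
  φ.numVars :: φ.numClauses :: φ.flatMap fun c => c.length :: c.map fun l => 2 * l.1 + l.2.toNat

/-- **CNF-SAT** as a fine-grained decision problem: instances `φ : CNF ℕ`, size `n = numVars φ`
(the parameter of SETH: no `2^{(1-ε) n}` algorithm), accept `[1]` iff `φ.Satisfiable`.
**Instance carrier only**: a `CNF ℕ` may repeat clauses without bound, so the input length
`2 + numClauses + size` is not controlled by `n` and `CNFSAT.InTime T`, `FGReducible CNFSAT …` are
vacuously false for size-only bounds. SETH/NSETH-type statements must be made about
`kSATProblem k` or `CNFSATWithSize c`. Impagliazzo–Paturi, JCSS 62 (2001); VVW ICM 2018, §3. [cite: ICM2018, §3] -/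
noncomputable def CNFSAT : FGProblem :=
  FGProblem.ofPred encodeCNFWords CNF.numVars CNF.Satisfiable

/-- **CNF-SAT with a polynomial clause budget**: `CNFSAT` restricted to formulas with
`numClauses φ + size φ ≤ (numVars φ + 1) ^ c`, so the encoding has length `≤ (n + 1)ᶜ + 2`. This is
the problem of the statement "SETH implies CNF-SAT on `n` variables and `poly(n)` clauses has no
`2^{(1-ε)n}` algorithm" (R. Williams, TCS 348 (2005), Thm 1; VVW ICM 2018, §3), quantified as
`∀ ε > 0, ∃ c, …`. [cite: ICM2018, §3] -/
noncomputable def CNFSATWithSize (c : ℕ) : FGProblem :=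
  CNFSAT.restrict {φ : CNF ℕ | φ.numClauses + φ.size ≤ (φ.numVars + 1) ^ c}

/-- **`k`-SAT** as a fine-grained decision problem: `CNFSAT` restricted to CNFs of width at most
`k` (`CNF.IsWidthLE k`) with no repeated clause (`List.Nodup`; removing duplicates is free, so this
is the `k`-SAT of print). Every variable is `< numVars φ = n`, so there are at most
`∑_{j ≤ k} (2n)^j` distinct clauses of width `≤ k` and the input length is polynomial in `n`, which
makes `2^{(1-ε)n}` bounds meaningful. Impagliazzo–Paturi, JCSS 62 (2001), §1. [folklore] -/
noncomputable def kSATProblem (k : ℕ) : FGProblem :=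
  CNFSAT.restrict {φ : CNF ℕ | CNF.IsWidthLE k φ ∧ List.Nodup φ}

/-! ## Sanity lemmas -/

/-- The size of an OV instance is its number of vectors `n`. [folklore] -/
@[simp] theorem OV_size (I : OVInstance) : OV.size I = I.n := rfl

/-- The size of an `OVWithDim c` instance is `n`. [folklore] -/
@[simp] theorem OVWithDim_size (c : ℕ) (I : (OVWithDim c).Inst) :
    (OVWithDim c).size I = I.1.n := rfl

/-- Accepted outputs of 3SUM: `[1]` on yes-instances, `[0]` on no-instances. [folklore] -/
theorem threeSUM_good_iff (l : threeSUM.Inst) (out : List ℕ) :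
    out ∈ threeSUM.Good l ↔ out = [if HasThreeSum l.1 then 1 else 0] := by
  change out ∈ (FGProblem.ofPred encodeIntList List.length HasThreeSum).Good l.1 ↔ _
  by_cases h : HasThreeSum l.1 <;> simp [h]

/-- The size of a 3SUM instance is the length of the list. [folklore] -/
@[simp] theorem threeSUM_size (l : threeSUM.Inst) : threeSUM.size l = l.1.length := rfl

/-- The size of a CNF-SAT instance is its number of variables. [folklore] -/
@[simp] theorem CNFSAT_size (φ : CNF ℕ) : CNFSAT.size φ = φ.numVars := rfl

open scoped Classical in
/-- Accepted outputs of CNF-SAT: `[1]` iff satisfiable (classical `if`). [folklore] -/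
theorem CNFSAT_good_iff (φ : CNF ℕ) (out : List ℕ) :
    out ∈ CNFSAT.Good φ ↔ out = [if φ.Satisfiable then 1 else 0] := by
  change out ∈ (FGProblem.ofPred encodeCNFWords CNF.numVars CNF.Satisfiable).Good φ ↔ _
  by_cases h : φ.Satisfiable <;> simp [h]

/-- The size of an APSP instance is its number of vertices. [folklore] -/
@[simp] theorem APSP_size (c : ℕ) (W : (APSP c).Inst) : (APSP c).size W = W.1.1 := rfl

/-- The accepted output of APSP is the encoded distance matrix. [folklore] -/
@[simp] theorem APSP_good (c : ℕ) (W : (APSP c).Inst) :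
    (APSP c).Good W = {encodeMatrixWithTop (shortestDist W.1.2)} := rfl

/-- The size of an Edit Distance instance is the total length. [folklore] -/
@[simp] theorem EditDistance_size (p : List Bool × List Bool) :
    EditDistance.size p = p.1.length + p.2.length := rfl

/-- **Floyd–Warshall**: APSP on `n`-vertex graphs with polynomially bounded weights is solvable in
`O(n³)` time on the word RAM (weights in `[-nᶜ, nᶜ]` and path lengths fit in `O(1)` words, so
each of the `n³` relaxations costs `O(1)`). R. W. Floyd, *Algorithm 97: shortest path*,
CACM 5 (1962); CLRS §25.2 (`FLOYD-WARSHALL` runs in `Θ(n³)`).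
[cite: FloydCACM1962, Algorithm 97] [cite: CLRS2009, §25.2 (Floyd–Warshall, Θ(n³))] -/
def APSP_inTimeO_cube : Prop :=
  ∀ (c : ℕ),
    (APSP c).InTimeO fun n => (n : ℝ) ^ 3

/-- **Wagner–Fischer**: edit distance of strings of total length `n` is computable in `O(n²)` time
on the word RAM (dynamic programme over the `(|s|+1) × (|t|+1)` table, `O(1)` per cell; here
`|s|·|t| ≤ n²`). Wagner–Fischer, *The string-to-string correction problem*, J. ACM 21 (1974),
Algorithm X with its `O(|A|·|B|)` time bound; CLRS Problem 15-5.
[cite: WagnerFischerJACM1974, Algorithm X (time O(|A|·|B|))] -/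
def EditDistance_inTimeO_sq : Prop :=
  EditDistance.InTimeO fun n => (n : ℝ) ^ 2

end Literature.Computability.Cryptography
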